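import Literature.Computability.AlgebraicComplexity.MS2001ClassVarieties
import Literature.Computability.AlgebraicComplexity.MS08Obstructions
import HarnessLib

/-!
# GCT I, §5.3.1 Example 2: stability is necessary in Thm. 5.1 (Mulmuley–Sohoni 2001)

Cell `val-lit` (D-0074 GROUP L), row MS2001-A (GCT I §4–§7), typer `val-lit-t01`. THEOREMS ONLY
(no definition, no named fact; D-0026). K. D. Mulmuley, M. Sohoni, *Geometric complexity theory I:
an approach to the P vs. NP and related problems*, SIAM J. Comput. 31 (2001) 496–526, §5.3
"Importance of stability" and §5.3.1 "Example 2" (authors' version = AV, 2001-04-23, p. 23; text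
of record `HOME/bip/texts/MS2001-authorversion/all.txt` L1602–1636), as printed:

> "The stability of `f` is crucial for Theorem 5.1 to hold." (L1603) […] "We give a simple example
> that demonstrates why stability of `f` is crucial for Theorem 5.1 to hold. Let `V` be the space
> of forms of total degree `3` in variables `x` and `y`, and `G = SL₂`. Let `f = x²y`, and
> `g = x³ + y³` [38]. Then it is easy to show that `f` lies in the projective closure `Δ[g]` of the
> `G`-orbit of `g` in `P(V)` […]. The stabilizer `H ⊆ G` of `f` for the `G`-action on `V` is
> trivial, hence reductive, but `f` is not stable for the `G`-action. The stabilizer `Q` of `g` is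
> equal to `{diag(ε, ε⁻¹) | ε³ = 1}`. Since `H` is trivial, any `G`-representation contains a
> trivial `H`-representation. Now there are `G`-representations which do not contain a trivial
> `Q`-representation; eg. the standard representation. Yet none of these is an obstruction for the
> pair `(f, g)`, since we already know that `f` lies in `Δ[g]`." (L1622–1636.)

The membership clause `f ∈ Δ[g]` is the tree's `MS2001_example_5_3_1` (`MS2001ClassVarieties.lean`,
every algebraically closed field of characteristic `0`). This file PROVES the remaining clauses, in
the vocabulary of the typed Thm. 5.1 (`MS2001_thm_5_1`: `G = slSubgroup σ F`, `W = Sym^r`,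
`dim W^H = finrank (fixedForms (slSubgroup σ F) f r)`):

* **"`H` is trivial"** — `MS2001_example_5_3_1_stabilizer_f`:
  `slSubgroup (Fin 2) k ⊓ linStabilizer (x²y) = ⊥` (every field of characteristic `0`; four
  evaluations of `(ax + by)²(cx + dy) = x²y` and `ad − bc = 1`).
* **"`f` is not stable"** — `MS2001_example_5_3_1_not_isPolystable` (every infinite field): the
  one-parameter subgroup `λ(t) = diag(t, t⁻¹) ⊆ SL₂` rescales `x²y` by `t`, so `0` lies in the
  Zariski closure of `SL₂ · f` (`zero_mem_zariskiClosure_slOrbit_of_smul_mem`, the tree's argument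
  of `MS08Obstructions.zero_mem_zariskiClosure_slOrbit_X_pow_mul_rename` for an abstract rescaling),
  whence `f` is not semistable (`…_not_isSLSemistable`) and not polystable
  (`IsPolystable.isSLSemistable`).
* **"`Q = {diag(ε, ε⁻¹) | ε³ = 1}`"** — `MS2001_example_5_3_1_stabilizer_g`: membership in
  `slSubgroup (Fin 2) k ⊓ linStabilizer (x³ + y³)` iff the matrix is `diag(ε, ε⁻¹)` with `ε³ = 1`
  (characteristic `0`; evaluations at `(1,0), (0,1), (1,±1)` give `a³ + c³ = b³ + d³ = 1`,
  `a²b + c²d = ab² + cd² = 0`, whence `ab = d·0 − c·0 − ab(ad − bc − 1) = 0`).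
* **"any `G`-representation contains a trivial `H`-representation … the standard representation
  [does not contain a trivial `Q`-representation]"**, for `W = Sym^r` —
  `fixedForms_slSubgroup_f_eq` (`W^H = Sym^r`, all `r`), `fixedForms_slSubgroup_g_one_eq_bot`
  (`(Sym¹)^Q = 0`, over an algebraically closed field of characteristic `0`: a primitive cube root
  of unity `ω` gives `diag(ω, ω²) ∈ Q` moving both coordinates), `finrank` forms.
* **The moral, formally** — `MS2001_example_5_3_1_criterion` (the multiplicity hypothesis of the
  typed Thm. 5.1 HOLDS for `(f, g) = (x²y, x³ + y³)` at `r = 1` although `f ∈ Δ[g]`) and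
  `MS2001_thm_5_1_false_without_stability`: the typed fact `MS2001_thm_5_1` with its binder
  `IsPolystable f` deleted is FALSE ("Yet none of these is an obstruction for the pair `(f, g)`").

Not restated: the dimension count "the `G`-orbit of `g` in `P(V)` is three dimensional, and that
of `f` is two dimensional" (no dimension theory of orbits in the tree). Honest framing: a 2001
textbook-level example ([38] = Popov–Vinberg); it documents that the stability binder of the typed
Thm. 5.1 cannot be dropped. VP ≠ VNP is NOT proved and nothing here bears on it.

## References

* [MulmuleySohoniSIAM2001] K. D. Mulmuley, M. Sohoni, *Geometric complexity theory I*, SIAM J.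
  Comput. 31 (2001) 496–526; AV §5.3 p. 23 (all.txt L1602–1621), §5.3.1 Example 2 (L1622–1636);
  Thm. 5.1 p. 20 (L1365).
* [38] = V. L. Popov, E. B. Vinberg, *Invariant theory*, Encyclopaedia Math. Sci. 55 (1994) (MS's
  reference for the example; cite-only).

## Design

`namespace Literature.Computability.AlgebraicComplexity`; helpers in the sub-namespace
`MS2001Example531`. `f = X 0 ^ 2 * X 1`, `g = X 0 ^ 3 + X 1 ^ 3 : MvPolynomial (Fin 2) k` inline (as
in `MS2001_example_5_3_1`). Matrix entries of a substitution `M` act by `x ↦ M₀₀ x + M₁₀ y`,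
`y ↦ M₀₁ x + M₁₁ y` (`linSubst`: `X i ↦ ∑ j, M j i • X j`). Imports: `MS2001ClassVarieties`
(`MS2001_example_5_3_1`, `slSubgroup`, `fixedForms`), `MS08Obstructions` (`IsSLSemistable`,
`IsPolystable.isSLSemistable`, `Grenet.linSubst_diagonal_X`). Standard axioms only.
-/

noncomputable section

open MvPolynomial Matrix Finset

namespace Literature.Computability.AlgebraicComplexity

namespace MS2001Example531

variable {k : Type*} [Field k]

/-! ## §0 Evaluation helpers -/

/-- Evaluating a linear substitution: `(M · f)(x) = f(Mᵀ x)` (private copy of the helper of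
`PerStabilizerMarcusMay.lean`). [folklore] -/
private theorem eval_linSubst {σ R : Type*} [Fintype σ] [CommRing R] (M : Matrix σ σ R) (x : σ → R)
    (f : MvPolynomial σ R) : eval x (linSubst σ R M f) = eval (Mᵀ *ᵥ x) f := by
  induction f using MvPolynomial.induction_on with
  | C a => rw [linSubst_C, eval_C, eval_C]
  | add p q hp hq => rw [map_add, map_add, map_add, hp, hq]
  | mul_X p i hp =>
    rw [map_mul, map_mul, map_mul, hp, linSubst_X, eval_X]
    congr 1
    simp [Matrix.mulVec, dotProduct, smul_eval]

/-- `Mᵀ (u, v) = (M₀₀ u + M₁₀ v, M₀₁ u + M₁₁ v)`. [folklore] -/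
private theorem transpose_mulVec_two (M : Matrix (Fin 2) (Fin 2) k) (u v : k) :
    Mᵀ *ᵥ ![u, v] = ![M 0 0 * u + M 1 0 * v, M 0 1 * u + M 1 1 * v] := by
  ext i
  fin_cases i <;> simp [Matrix.mulVec, dotProduct, Fin.sum_univ_two]

/-- `f = x²y` at a point. [folklore] -/
private theorem eval_f (u v : k) : eval ![u, v] (X 0 ^ 2 * X 1 : MvPolynomial (Fin 2) k) = u ^ 2 * v := by
  simp

/-- `g = x³ + y³` at a point. [folklore] -/
private theorem eval_g (u v : k) :
    eval ![u, v] (X 0 ^ 3 + X 1 ^ 3 : MvPolynomial (Fin 2) k) = u ^ 3 + v ^ 3 := by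
  simp

/-- The four evaluations of a fixed-point identity `M · p = p` at `(1,0), (0,1), (1,1), (1,−1)`.
[folklore] -/
private theorem eval_four {p : MvPolynomial (Fin 2) k} {M : Matrix (Fin 2) (Fin 2) k}
    (h : linSubst (Fin 2) k M p = p) (u v : k) :
    eval ![M 0 0 * u + M 1 0 * v, M 0 1 * u + M 1 1 * v] p = eval ![u, v] p := by
  have := congrArg (eval ![u, v]) h
  rwa [eval_linSubst, transpose_mulVec_two] at this

/-! ## §1 "The stabilizer `H ⊆ G` of `f` … is trivial" -/

/-- **`H` is trivial** (MS 2001, §5.3.1, AV p.23 L1629–1630): a determinant-one substitution of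
`k²` fixing `x²y` is the identity (characteristic `0`). From `(ax+by)²(cx+dy) = x²y` at
`(1,0), (0,1), (1,±1)`: `a²c = b²d = 0`, `a²d + 2abc = 1`, `b²c + 2abd = 0`; with `ad − bc = 1`
this forces `a = d = 1`, `b = c = 0`.
[cite: MulmuleySohoniSIAM2001, §5.3.1 Example 2 (AV p.23, all.txt L1629–1630)] -/
theorem eq_one_of_det_eq_one_of_fix_f [CharZero k] {γ : GL (Fin 2) k}
    (hdet : Matrix.det (γ : Matrix (Fin 2) (Fin 2) k) = 1)
    (hfix : linSubstRep (Fin 2) k γ (X 0 ^ 2 * X 1 : MvPolynomial (Fin 2) k) = X 0 ^ 2 * X 1) :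
    γ = 1 := by
  set M : Matrix (Fin 2) (Fin 2) k := (γ : Matrix (Fin 2) (Fin 2) k) with hM
  rw [linSubstRep_apply] at hfix
  have h10 := eval_four hfix 1 0
  have h01 := eval_four hfix 0 1
  have h11 := eval_four hfix 1 1
  have h1m := eval_four hfix 1 (-1)
  simp only [eval_f, mul_one, mul_zero, add_zero, zero_add, mul_neg] at h10 h01 h11 h1m
  rw [Matrix.det_fin_two] at hdet
  -- abbreviations
  set a := M 0 0
  set b := M 1 0
  set c := M 0 1
  set d := M 1 1
  have hP2 : (2 : k) * (a ^ 2 * d + 2 * a * b * c) = 2 * 1 := by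
    linear_combination h11 - h1m - 2 * h01
  have hP : a ^ 2 * d + 2 * a * b * c = 1 := mul_left_cancel₀ two_ne_zero hP2
  have ha : a ≠ 0 := by
    intro ha
    rw [ha] at hP
    norm_num at hP
  have hc : c = 0 := by
    have : a ^ 2 * c = 0 := by linear_combination h10
    rcases mul_eq_zero.mp this with h | h
    · exact absurd (pow_eq_zero_iff two_ne_zero |>.mp h) ha
    · exact h
  have hP' : a ^ 2 * d = 1 := by rw [hc] at hP; linear_combination hP
  have hd : d ≠ 0 := by
    intro hd0
    rw [hd0, mul_zero] at hP'
    exact zero_ne_one hP'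
  have hb : b = 0 := by
    have : b ^ 2 * d = 0 := by linear_combination h01
    rcases mul_eq_zero.mp this with h | h
    · exact pow_eq_zero_iff two_ne_zero |>.mp h
    · exact absurd h hd
  have hdet' : a * d = 1 := by rw [hc] at hdet; linear_combination hdet
  have ha1 : a = 1 := by linear_combination (-a) * hdet' + hP'
  have hd1 : d = 1 := by rw [ha1, one_mul] at hdet'; exact hdet'
  refine Units.ext ?_
  change M = 1
  ext i j
  fin_cases i <;> fin_cases j
  · exact ha1
  · exact hc
  · exact hb
  · exact hd1

end MS2001Example531

open MS2001Example531

/-- **GCT I §5.3.1 Example 2 — "The stabilizer `H ⊆ G` of `f` for the `G`-action on `V` is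
trivial"** (`f = x²y`, `G = SL₂`; AV p.23, all.txt L1629–1630), PROVED over every field of
characteristic `0`: `SL₂ ∩ Stab(x²y) = 1`.
[cite: MulmuleySohoniSIAM2001, §5.3.1 Example 2 (AV p.23, all.txt L1629–1630)] -/
theorem MS2001_example_5_3_1_stabilizer_f (k : Type*) [Field k] [CharZero k] :
    slSubgroup (Fin 2) k ⊓ linStabilizer (X 0 ^ 2 * X 1 : MvPolynomial (Fin 2) k) = ⊥ := by
  rw [Subgroup.eq_bot_iff_forall]
  intro γ hγ
  rw [Subgroup.mem_inf, mem_slSubgroup_iff, mem_linStabilizer] at hγ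
  exact eq_one_of_det_eq_one_of_fix_f hγ.1 hγ.2

/-- **"Since `H` is trivial, any `G`-representation contains a trivial `H`-representation"** — for
`W = Sym^r`: `W^H = W`, i.e. `fixedForms (slSubgroup (Fin 2) k) (x²y) r` is all of `Sym^r`
(characteristic `0`). [cite: MulmuleySohoniSIAM2001, §5.3.1 Example 2 (AV p.23, all.txt L1631–1632)] -/
theorem fixedForms_slSubgroup_f_eq (k : Type*) [Field k] [CharZero k] (r : ℕ) :
    fixedForms (slSubgroup (Fin 2) k) (X 0 ^ 2 * X 1 : MvPolynomial (Fin 2) k) r =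
      homogeneousSubmodule (Fin 2) k r := by
  refine le_antisymm (fun p hp => hp.1) fun p hp => ?_
  refine mem_fixedForms_iff.mpr ⟨(mem_homogeneousSubmodule _ _).mp hp, fun γ hγ hfix => ?_⟩
  rw [eq_one_of_det_eq_one_of_fix_f (mem_slSubgroup_iff.mp hγ) hfix, map_one]
  rfl

namespace MS2001Example531

/-! ## §2 "but `f` is not stable for the `G`-action" -/

variable {k : Type*} [Field k] {σ : Type*} [Fintype σ] [DecidableEq σ]

omit [Fintype σ] [DecidableEq σ] in
/-- `coeffVec` is linear in the scalar. [folklore] -/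
private theorem coeffVec_smul' (c : k) (f : MvPolynomial σ k) : coeffVec (c • f) = c • coeffVec f := by
  funext d
  simp [coeffVec_apply]

omit [Fintype σ] [DecidableEq σ] in
/-- `coeffVec 0 = 0`. [folklore] -/
private theorem coeffVec_zero' : coeffVec (0 : MvPolynomial σ k) = 0 := by
  funext d
  simp [coeffVec_apply]

/-- **A form rescaled by a one-parameter subgroup is unstable** (the argument of the tree's
`zero_mem_zariskiClosure_slOrbit_X_pow_mul_rename`, `MS08Obstructions.lean`, for an abstract
rescaling): if for every `t ≠ 0` some element of `SL` sends `f` to `t^e f` (`e > 0`), then `0`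
lies in the Zariski closure of the coefficient vectors of `SL · f` (a polynomial vanishing on the
orbit vanishes at `t^e · f̂` for all `t ≠ 0`, hence, as a one-variable polynomial in `t` over an
infinite field, identically, hence at `t = 0`). [cite: MulmuleySohoniGCT2SIAM2008, §2 remark after Def. 2.1 (Hilbert–Mumford), arXiv cs/0612134 main.tex L716–718] -/
theorem zero_mem_zariskiClosure_slOrbit_of_smul_mem [Infinite k] {f : MvPolynomial σ k} {e : ℕ}
    (he : 0 < e) (h : ∀ t : k, t ≠ 0 → t ^ e • f ∈ slOrbit σ k f) :
    coeffVec (0 : MvPolynomial σ k) ∈ zariskiClosure (coeffVec '' slOrbit σ k f) := by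
  rw [mem_zariskiClosure_iff]
  intro p hp
  -- the one-variable polynomial `t ↦ p(t^e • coeffVec f)`
  set R : Polynomial k :=
    aeval (fun d : σ →₀ ℕ => Polynomial.X ^ e * Polynomial.C (coeffVec f d)) p with hR
  have hReval : ∀ t : k, Polynomial.aeval t R = aeval (t ^ e • coeffVec f) p := by
    intro t
    rw [hR, ← AlgHom.comp_apply]
    congr 1
    apply MvPolynomial.algHom_ext
    intro d
    simp [Pi.smul_apply, smul_eq_mul]
    ring
  have hroots : ∀ t : k, t ≠ 0 → R.IsRoot t := by
    intro t ht
    rw [Polynomial.IsRoot, ← Polynomial.coe_aeval_eq_eval, hReval, ← coeffVec_smul']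
    exact hp _ ⟨t ^ e • f, h t ht, rfl⟩
  have hR0 : R = 0 := by
    apply Polynomial.eq_zero_of_infinite_isRoot
    exact ((Set.finite_singleton (0 : k)).infinite_compl).mono fun t ht => hroots t ht
  have := hReval 0
  rw [hR0, map_zero, zero_pow (Nat.pos_iff_ne_zero.mp he), zero_smul] at this
  rw [coeffVec_zero']
  exact this.symm

/-- The one-parameter subgroup `λ(t) = diag(t, t⁻¹) ⊆ SL₂` rescales `x²y` by `t`:
`λ(t) · x²y = (tx)²(t⁻¹y) = t · x²y` (`t ≠ 0`). [folklore] -/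
private theorem linSubst_diag_f (t : k) (ht : t ≠ 0) :
    linSubst (Fin 2) k (Matrix.diagonal ![t, t⁻¹]) (X 0 ^ 2 * X 1 : MvPolynomial (Fin 2) k) =
      t • (X 0 ^ 2 * X 1) := by
  rw [map_mul, map_pow, Grenet.linSubst_diagonal_X, Grenet.linSubst_diagonal_X]
  simp only [Matrix.cons_val_zero, Matrix.cons_val_one, smul_pow, smul_mul_smul]
  rw [pow_two, mul_assoc, mul_inv_cancel₀ ht, mul_one]

/-- **`0 ∈ \overline{SL₂ · x²y}`** (Zariski closure in coefficient space; every infinite field): via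
`λ(t) = diag(t, t⁻¹)`. [cite: MulmuleySohoniSIAM2001, §5.3.1 Example 2 (AV p.23, all.txt L1630: "`f` is not stable for the `G`-action")] -/
theorem zero_mem_zariskiClosure_slOrbit_f [Infinite k] :
    coeffVec (0 : MvPolynomial (Fin 2) k) ∈
      zariskiClosure (coeffVec '' slOrbit (Fin 2) k (X 0 ^ 2 * X 1 : MvPolynomial (Fin 2) k)) := by
  refine zero_mem_zariskiClosure_slOrbit_of_smul_mem (e := 1) one_pos fun t ht => ?_
  have hdet : (Matrix.diagonal ![t, t⁻¹]).det = 1 := by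
    rw [Matrix.det_diagonal, Fin.prod_univ_two]
    simp [mul_inv_cancel₀ ht]
  exact ⟨⟨Matrix.diagonal ![t, t⁻¹], hdet⟩, by rw [pow_one]; exact (linSubst_diag_f t ht).symm⟩

end MS2001Example531

/-- **GCT I §5.3.1 Example 2 — `f = x²y` is not semistable under `SL₂`** (its orbit closure
contains `0`; MS: "`f` is not stable for the `G`-action", AV p.23 L1630; the null-cone membership is
the standard Hilbert–Mumford picture of [38]), every infinite field.
[cite: MulmuleySohoniSIAM2001, §5.3.1 Example 2 (AV p.23, all.txt L1629–1630)] -/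
theorem MS2001_example_5_3_1_not_isSLSemistable (k : Type*) [Field k] [Infinite k] :
    ¬ IsSLSemistable (X 0 ^ 2 * X 1 : MvPolynomial (Fin 2) k) :=
  not_isSLSemistable_iff.mpr zero_mem_zariskiClosure_slOrbit_f

/-- **GCT I §5.3.1 Example 2 — "but `f` is not stable for the `G`-action"** (`f = x²y`, `G = SL₂`,
AV p.23 L1630), in the tree's rendering `¬ IsPolystable (x²y)` (the `SL₂`-orbit is not Zariski
closed: it is not even semistable), every infinite field.
[cite: MulmuleySohoniSIAM2001, §5.3.1 Example 2 (AV p.23, all.txt L1629–1630)] -/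
theorem MS2001_example_5_3_1_not_isPolystable (k : Type*) [Field k] [Infinite k] :
    ¬ IsPolystable (X 0 ^ 2 * X 1 : MvPolynomial (Fin 2) k) := by
  intro h
  refine MS2001_example_5_3_1_not_isSLSemistable k (h.isSLSemistable ?_)
  intro h0
  have := congrArg (eval ![(1 : k), 1]) h0
  simp at this

namespace MS2001Example531

/-! ## §3 "The stabilizer `Q` of `g` is equal to `{diag(ε, ε⁻¹) | ε³ = 1}`" -/

variable {k : Type*} [Field k]

/-- **`{diag(ε, ε⁻¹) | ε³ = 1} ⊆ Q`, the easy inclusion** of MS's "The stabilizer `Q` of `g` is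
equal to `{diag(ε, ε⁻¹) | ε³ = 1}`" (AV p.23 L1630–1631): `(εx)³ + (ε⁻¹y)³ = x³ + y³` (any field).
[cite: MulmuleySohoniSIAM2001, §5.3.1 Example 2 (AV p.23, all.txt L1630–1631)] -/
theorem linSubst_diag_g {ε : k} (hε : ε ^ 3 = 1) :
    linSubst (Fin 2) k (Matrix.diagonal ![ε, ε⁻¹]) (X 0 ^ 3 + X 1 ^ 3 : MvPolynomial (Fin 2) k) =
      X 0 ^ 3 + X 1 ^ 3 := by
  have hε0 : ε ≠ 0 := by
    rintro rfl
    norm_num at hε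
  rw [map_add, map_pow, map_pow, Grenet.linSubst_diagonal_X, Grenet.linSubst_diagonal_X]
  simp only [Matrix.cons_val_zero, Matrix.cons_val_one, smul_pow, inv_pow, hε, inv_one, one_smul]

/-- **`Q = {diag(ε, ε⁻¹) | ε³ = 1}`, the hard inclusion** (MS 2001, §5.3.1, AV p.23 L1630–1631):
a determinant-one substitution fixing `x³ + y³` is `diag(ε, ε⁻¹)` with `ε³ = 1` (characteristic
`0`). Evaluations at `(1,0), (0,1), (1,±1)`: `a³ + c³ = b³ + d³ = 1`, `a²b + c²d = ab² + cd² = 0`;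
then `ab = d(a²b + c²d) − c(ab² + cd²) − ab(ad − bc − 1) = 0`; `b = 0` gives the diagonal form,
`a = 0` is impossible (`(bc)³ = 1 = −1`).
[cite: MulmuleySohoniSIAM2001, §5.3.1 Example 2 (AV p.23, all.txt L1630–1631)] -/
theorem exists_eq_diagonal_of_det_eq_one_of_fix_g [CharZero k] {γ : GL (Fin 2) k}
    (hdet : Matrix.det (γ : Matrix (Fin 2) (Fin 2) k) = 1)
    (hfix : linSubstRep (Fin 2) k γ (X 0 ^ 3 + X 1 ^ 3 : MvPolynomial (Fin 2) k) = X 0 ^ 3 + X 1 ^ 3) :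
    ∃ ε : k, ε ^ 3 = 1 ∧ (γ : Matrix (Fin 2) (Fin 2) k) = Matrix.diagonal ![ε, ε⁻¹] := by
  set M : Matrix (Fin 2) (Fin 2) k := (γ : Matrix (Fin 2) (Fin 2) k) with hM
  rw [linSubstRep_apply] at hfix
  have h10 := eval_four hfix 1 0
  have h01 := eval_four hfix 0 1
  have h11 := eval_four hfix 1 1
  have h1m := eval_four hfix 1 (-1)
  simp only [eval_g, mul_one, mul_zero, add_zero, zero_add, mul_neg] at h10 h01 h11 h1m
  rw [Matrix.det_fin_two] at hdet
  set a := M 0 0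
  set b := M 1 0
  set c := M 0 1
  set d := M 1 1
  have hac : a ^ 3 + c ^ 3 = 1 := by linear_combination h10
  have hbd : b ^ 3 + d ^ 3 = 1 := by linear_combination h01
  have hT6 : (6 : k) * (a * b ^ 2 + c * d ^ 2) = 6 * 0 := by
    linear_combination h11 + h1m - 2 * h10
  have hT : a * b ^ 2 + c * d ^ 2 = 0 := mul_left_cancel₀ (by norm_num) hT6
  have hS3 : (3 : k) * (a ^ 2 * b + c ^ 2 * d) = 3 * 0 := by
    linear_combination h11 - h10 - h01 - 3 * hT
  have hS : a ^ 2 * b + c ^ 2 * d = 0 := mul_left_cancel₀ (by norm_num) hS3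
  have hab : a * b = 0 := by linear_combination d * hS - c * hT - (a * b) * hdet
  rcases mul_eq_zero.mp hab with ha | hb
  · -- `a = 0` is impossible
    exfalso
    have hcb : c * b = -1 := by rw [ha] at hdet; linear_combination -hdet
    have hc : c ≠ 0 := by
      intro hc0; rw [hc0, zero_mul] at hcb; norm_num at hcb
    have hd0 : d = 0 := by
      have : c ^ 2 * d = 0 := by rw [ha] at hS; linear_combination hS
      rcases mul_eq_zero.mp this with h | h
      · exact absurd (pow_eq_zero_iff two_ne_zero |>.mp h) hc
      · exact h
    have hc3 : c ^ 3 = 1 := by rw [ha] at hac; linear_combination hac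
    have hb3 : b ^ 3 = 1 := by rw [hd0] at hbd; linear_combination hbd
    have : (c * b) ^ 3 = 1 := by rw [mul_pow, hc3, hb3, one_mul]
    rw [hcb] at this
    norm_num at this
  · -- `b = 0`: the diagonal form
    have hd : d ≠ 0 := by
      intro hd0
      rw [hb, hd0] at hdet
      norm_num at hdet
    have hc : c = 0 := by
      have : c ^ 2 * d = 0 := by rw [hb] at hS; linear_combination hS
      rcases mul_eq_zero.mp this with h | h
      · exact pow_eq_zero_iff two_ne_zero |>.mp h
      · exact absurd h hd
    have ha3 : a ^ 3 = 1 := by rw [hc] at hac; linear_combination hac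
    have had : a * d = 1 := by rw [hb, hc] at hdet; linear_combination hdet
    refine ⟨a, ha3, ?_⟩
    have hdinv : d = a⁻¹ := (inv_eq_of_mul_eq_one_right had).symm
    ext i j
    fin_cases i <;> fin_cases j
    · simp [a]
    · simpa using hc
    · simpa using hb
    · show d = Matrix.diagonal ![a, a⁻¹] 1 1
      rw [hdinv]
      simp

end MS2001Example531

/-- **GCT I §5.3.1 Example 2 — "The stabilizer `Q` of `g` is equal to `{diag(ε, ε⁻¹) | ε³ = 1}`"**
(`g = x³ + y³`, `G = SL₂`; AV p.23, all.txt L1630–1631), PROVED over every field of characteristic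
`0`: `γ ∈ SL₂ ∩ Stab(x³ + y³)` iff `γ = diag(ε, ε⁻¹)` with `ε³ = 1`.
[cite: MulmuleySohoniSIAM2001, §5.3.1 Example 2 (AV p.23, all.txt L1630–1631)] -/
theorem MS2001_example_5_3_1_stabilizer_g (k : Type*) [Field k] [CharZero k] (γ : GL (Fin 2) k) :
    γ ∈ slSubgroup (Fin 2) k ⊓ linStabilizer (X 0 ^ 3 + X 1 ^ 3 : MvPolynomial (Fin 2) k) ↔
      ∃ ε : k, ε ^ 3 = 1 ∧ (γ : Matrix (Fin 2) (Fin 2) k) = Matrix.diagonal ![ε, ε⁻¹] := by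
  rw [Subgroup.mem_inf, mem_slSubgroup_iff, mem_linStabilizer]
  constructor
  · rintro ⟨hdet, hfix⟩
    exact exists_eq_diagonal_of_det_eq_one_of_fix_g hdet hfix
  · rintro ⟨ε, hε, hγ⟩
    have hε0 : ε ≠ 0 := by
      rintro rfl
      norm_num at hε
    refine ⟨?_, ?_⟩
    · rw [hγ, Matrix.det_diagonal, Fin.prod_univ_two]
      simp [mul_inv_cancel₀ hε0]
    · rw [linSubstRep_apply, hγ, linSubst_diag_g hε]

/-- **"there are `G`-representations which do not contain a trivial `Q`-representation; eg. the
standard representation"** (AV p.23 L1632–1634), for `W = Sym¹` (linear forms, the dual standard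
representation of `SL₂`): `(Sym¹)^Q = 0`, i.e. `fixedForms (slSubgroup (Fin 2) k) (x³ + y³) 1 = ⊥`,
over an algebraically closed field of characteristic `0` (`diag(ω, ω²) ∈ Q` for a primitive cube
root of unity `ω` moves `x` and `y`). [cite: MulmuleySohoniSIAM2001, §5.3.1 Example 2 (AV p.23, all.txt L1632–1634)] -/
theorem fixedForms_slSubgroup_g_one_eq_bot (k : Type*) [Field k] [IsAlgClosed k] [CharZero k] :
    fixedForms (slSubgroup (Fin 2) k) (X 0 ^ 3 + X 1 ^ 3 : MvPolynomial (Fin 2) k) 1 = ⊥ := by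
  -- a primitive cube root of unity
  obtain ⟨ω, hω⟩ : ∃ ω : k, ω ^ 2 + ω + 1 = 0 := by
    obtain ⟨ω, hω⟩ := IsAlgClosed.exists_root
      (Polynomial.C 1 * Polynomial.X ^ 2 + Polynomial.C 1 * Polynomial.X + Polynomial.C 1 :
        Polynomial k) (by
        rw [Polynomial.degree_quadratic one_ne_zero]
        norm_num)
    refine ⟨ω, ?_⟩
    have := hω.eq_zero
    simpa using this
  have hω3 : ω ^ 3 = 1 := by linear_combination (ω - 1) * hω
  have hω1 : ω ≠ 1 := by
    intro h; rw [h] at hω; norm_num at hω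
  have hω2 : ω ^ 2 ≠ 1 := by
    intro h
    have : ω = -2 := by linear_combination hω - h
    rw [this] at h
    norm_num at h
  -- `diag(ω, ω²) = diag(ω, ω⁻¹) ∈ SL₂ ∩ Stab(g)`
  have hω0 : ω ≠ 0 := by rintro rfl; norm_num at hω3
  have hωinv : ω⁻¹ = ω ^ 2 := by
    rw [inv_eq_of_mul_eq_one_right]
    linear_combination hω3
  have hdet : (Matrix.diagonal ![ω, ω⁻¹]).det = 1 := by
    rw [Matrix.det_diagonal, Fin.prod_univ_two]
    simp [mul_inv_cancel₀ hω0]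
  set γ : GL (Fin 2) k := Matrix.SpecialLinearGroup.toGL ⟨Matrix.diagonal ![ω, ω⁻¹], hdet⟩
  have hγcoe : ((γ : GL (Fin 2) k) : Matrix (Fin 2) (Fin 2) k) = Matrix.diagonal ![ω, ω⁻¹] := rfl
  have hγsl : γ ∈ slSubgroup (Fin 2) k := ⟨_, rfl⟩
  have hγg : linSubstRep (Fin 2) k γ (X 0 ^ 3 + X 1 ^ 3 : MvPolynomial (Fin 2) k) = X 0 ^ 3 + X 1 ^ 3 := by
    rw [linSubstRep_apply, hγcoe, linSubst_diag_g hω3]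
  rw [Submodule.eq_bot_iff]
  intro p hp
  obtain ⟨hp1, hfix⟩ := mem_fixedForms_iff.mp hp
  -- `p = c₀ x + c₁ y`
  have hpspan : p ∈ Submodule.span k (Set.range (X : Fin 2 → MvPolynomial (Fin 2) k)) := by
    rw [← homogeneousSubmodule_one_eq_span_X]
    exact (mem_homogeneousSubmodule _ _).mpr hp1
  obtain ⟨c, hc⟩ := (Submodule.mem_span_range_iff_exists_fun k).mp hpspan
  rw [Fin.sum_univ_two] at hc
  -- `γ · p = c₀ ω x + c₁ ω² y = p`
  have hγp := hfix γ hγsl hγg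
  rw [linSubstRep_apply, hγcoe, ← hc, map_add, map_smul, map_smul, Grenet.linSubst_diagonal_X,
    Grenet.linSubst_diagonal_X] at hγp
  simp only [Matrix.cons_val_zero, Matrix.cons_val_one] at hγp
  -- compare the values at `(1,0)` and `(0,1)`
  have h0 := congrArg (eval ![(1 : k), 0]) hγp
  have h1 := congrArg (eval ![(0 : k), 1]) hγp
  simp only [map_add, smul_eval, eval_X, Matrix.cons_val_zero, Matrix.cons_val_one,
    mul_one, mul_zero, add_zero, zero_add] at h0 h1
  have hc0 : c 0 = 0 := by
    have : c 0 * (ω - 1) = 0 := by linear_combination h0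
    rcases mul_eq_zero.mp this with h | h
    · exact h
    · exact absurd (sub_eq_zero.mp h) hω1
  have hc1 : c 1 = 0 := by
    have : c 1 * (ω ^ 2 - 1) = 0 := by rw [← hωinv]; linear_combination h1
    rcases mul_eq_zero.mp this with h | h
    · exact h
    · exact absurd (sub_eq_zero.mp h) hω2
  rw [← hc, hc0, hc1, zero_smul, zero_smul, add_zero]

/-- `dim (Sym¹)^Q = 0` for `Q = SL₂ ∩ Stab(x³ + y³)` (algebraically closed, characteristic `0`).
[cite: MulmuleySohoniSIAM2001, §5.3.1 Example 2 (AV p.23, all.txt L1632–1634)] -/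
theorem finrank_fixedForms_slSubgroup_g_one (k : Type*) [Field k] [IsAlgClosed k] [CharZero k] :
    Module.finrank k (fixedForms (slSubgroup (Fin 2) k) (X 0 ^ 3 + X 1 ^ 3 : MvPolynomial (Fin 2) k) 1) = 0 := by
  rw [fixedForms_slSubgroup_g_one_eq_bot, finrank_bot]

/-- `dim (Sym¹)^H > 0` for the trivial `H = SL₂ ∩ Stab(x²y)` (`x ∈ (Sym¹)^H = Sym¹`; characteristic
`0`). [cite: MulmuleySohoniSIAM2001, §5.3.1 Example 2 (AV p.23, all.txt L1631–1632)] -/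
theorem finrank_fixedForms_slSubgroup_f_one_pos (k : Type*) [Field k] [CharZero k] :
    0 < Module.finrank k (fixedForms (slSubgroup (Fin 2) k) (X 0 ^ 2 * X 1 : MvPolynomial (Fin 2) k) 1) := by
  rw [fixedForms_slSubgroup_f_eq]
  haveI : Module.Finite k ↥(homogeneousSubmodule (Fin 2) k 1) := finite_homogeneousSubmodule _ k _
  have hX : (X 0 : MvPolynomial (Fin 2) k) ∈ homogeneousSubmodule (Fin 2) k 1 :=
    (mem_homogeneousSubmodule _ _).mpr (isHomogeneous_X k 0)
  have hle : k ∙ (X 0 : MvPolynomial (Fin 2) k) ≤ homogeneousSubmodule (Fin 2) k 1 := by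
    rw [Submodule.span_le, Set.singleton_subset_iff]; exact hX
  calc 0 < 1 := one_pos
    _ = Module.finrank k (k ∙ (X 0 : MvPolynomial (Fin 2) k)) :=
      (finrank_span_singleton (X_ne_zero 0)).symm
    _ ≤ _ := Submodule.finrank_mono hle

/-! ## §4 The moral: the multiplicity criterion holds for `(x²y, x³ + y³)`, yet `x²y ∈ Δ[x³ + y³]` -/

/-- **GCT I §5.3.1 — the hypothesis of Thm. 5.1's multiplicity criterion HOLDS for
`(f, g) = (x²y, x³ + y³)`** at `W = Sym¹` ("Since `H` is trivial, any `G`-representation contains a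
trivial `H`-representation. Now there are `G`-representations which do not contain a trivial
`Q`-representation; eg. the standard representation", AV p.23 L1631–1634): in the typed shape of
`MS2001_thm_5_1`, `∃ r, dim (Sym^r)^Q < dim (Sym^r)^H` (algebraically closed, characteristic `0`).
[cite: MulmuleySohoniSIAM2001, §5.3.1 Example 2 (AV p.23, all.txt L1631–1634)] -/
theorem MS2001_example_5_3_1_criterion (k : Type*) [Field k] [IsAlgClosed k] [CharZero k] :
    ∃ r : ℕ, Module.finrank k (fixedForms (slSubgroup (Fin 2) k)
        (X 0 ^ 3 + X 1 ^ 3 : MvPolynomial (Fin 2) k) r) <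
      Module.finrank k (fixedForms (slSubgroup (Fin 2) k) (X 0 ^ 2 * X 1 : MvPolynomial (Fin 2) k) r) :=
  ⟨1, by rw [finrank_fixedForms_slSubgroup_g_one]; exact finrank_fixedForms_slSubgroup_f_one_pos k⟩

/-- **GCT I §5.3 / §5.3.1 — "The stability of `f` is crucial for Theorem 5.1 to hold … Yet none of
these is an obstruction for the pair `(f, g)`, since we already know that `f` lies in `Δ[g]`"**
(AV p.23, all.txt L1603, L1634–1636), FORMALLY: the typed fact `MS2001_thm_5_1`
(`MS2001ClassVarieties.lean`) with its stability binder `IsPolystable f` DELETED is false — witness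
`F = ℂ`, `σ = Fin 2`, `f = x²y`, `g = x³ + y³`, `m = 3`, `r = 1` (`MS2001_example_5_3_1_criterion`
and the tree's `MS2001_example_5_3_1 : x²y ∈ Δ[x³ + y³]`). PROVED.
[cite: MulmuleySohoniSIAM2001, §5.3 (AV p.23, all.txt L1603) and §5.3.1 Example 2 (L1622–1636)] -/
theorem MS2001_thm_5_1_false_without_stability :
    ¬ (∀ (F : Type) [Field F] [IsAlgClosed F] [CharZero F] (σ : Type) [Fintype σ] [DecidableEq σ]
        (f g : MvPolynomial σ F) (m : ℕ), f.IsHomogeneous m → g.IsHomogeneous m →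
        (∃ r : ℕ, Module.finrank F (fixedForms (slSubgroup σ F) g r) <
          Module.finrank F (fixedForms (slSubgroup σ F) f r)) →
        f ∉ orbitClosure g) := by
  intro h
  have hf : (X 0 ^ 2 * X 1 : MvPolynomial (Fin 2) ℂ).IsHomogeneous 3 := by
    simpa using ((isHomogeneous_X ℂ (0 : Fin 2)).pow 2).mul (isHomogeneous_X ℂ (1 : Fin 2))
  have hg : (X 0 ^ 3 + X 1 ^ 3 : MvPolynomial (Fin 2) ℂ).IsHomogeneous 3 := by
    simpa using ((isHomogeneous_X ℂ (0 : Fin 2)).pow 3).add ((isHomogeneous_X ℂ (1 : Fin 2)).pow 3)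
  exact h ℂ (Fin 2) (X 0 ^ 2 * X 1) (X 0 ^ 3 + X 1 ^ 3) 3 hf hg (MS2001_example_5_3_1_criterion ℂ)
    MS2001_example_5_3_1

end Literature.Computability.AlgebraicComplexity

end
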